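import Summits.CriticalPhenomena.Ising3DConformalLimit.Theorems.ArmHyperscalingOneArmHyperscalingMirrorFaceDefs
import Literature.Probability.LatticeModels.GHSTruncatedVolumeMonotonicity
import HarnessLib

/-!
# Discrete GHS submodularity of the plus magnetisation in the frozen set
(route ArmHyperscaling, crux `OneArmHyperscaling`, item stmt-CriticalPhenomena-15591, line
`mirror-face-saturation`, registered stub `stub_plusMagSubmodular : PlusMagSubmodular`)

Statement (`stub_plusMagSubmodular`, literally the line's `def PlusMagSubmodular : Prop` of the
definitions module `Theorems/ArmHyperscalingOneArmHyperscalingMirrorFaceDefs.lean`): on `ℤ³`, for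
`β, h ≥ 0`, a finite volume `Λ ∋ x` and `m` pairwise disjoint sets `E_i ⊆ Λ ∖ {x}`, writing
`M(V) := ⟨σ_x⟩⁺_{V;β,h}` (the sites removed from the volume are frozen to `+1` by the `+` boundary
condition),
`M(Λ ∖ ⋃_i E_i) + m · M(Λ) ≤ Σ_i M(Λ ∖ E_i) + M(Λ)`.

Proof (discrete, one site at a time, no limit of fields; the template is the tree file
`Literature/Probability/LatticeModels/GHSTruncatedVolumeMonotonicity.lean`).
1. One-site increment (`mag_erase_sub_eq`): for `z ∈ V`, the spatial Markov property
   `⟨F⟩⁺_{V∖z}(1 + ⟨σ_z⟩⁺_V) = ⟨F⟩⁺_V + ⟨Fσ_z⟩⁺_V` (Friedli–Velenik 2017, eq. (3.26); tree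
   `isingExpect_plus_cond`) with `F = σ_x` gives
   `M(V ∖ z) − M(V) = ⟨σ_x;σ_z⟩⁺_V / (1 + ⟨σ_z⟩⁺_V)`.
2. Monotonicity of the increment in the volume (`mag_erase_sub_mono`): for `x, z ∈ V₁ ⊆ V₂`,
   `0 ≤ ⟨σ_x;σ_z⟩⁺_{V₁} ≤ ⟨σ_x;σ_z⟩⁺_{V₂}` (FKG, tree `ising_fkg_holds`; GHS, Lebowitz 1974, tree
   `isingTrunc_plus_mono_volume`) and `0 < 1 + ⟨σ_z⟩⁺_{V₂} ≤ 1 + ⟨σ_z⟩⁺_{V₁}` (tree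
   `one_add_isingExpect_spinAt_pos`, GKS antitonicity `isingCorr_plus_le_of_subset`), hence
   `M(V₁ ∖ z) − M(V₁) ≤ M(V₂ ∖ z) − M(V₂)`.
3. Peeling a finite set `B ∌ x`, `B ⊆ V₁`, one site at a time (`mag_sdiff_sub_mono`):
   `M(V₁ ∖ B) − M(V₁) ≤ M(V₂ ∖ B) − M(V₂)`.
4. Induction on the family (`mag_submodular_finset`, any finite index set): with `A = ⋃_{i ∈ s} E_i`,
   step 3 for `V₁ = Λ ∖ A ⊆ V₂ = Λ`, `B = E_j` (disjoint from `A`) is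
   `M(Λ ∖ (E_j ∪ A)) − M(Λ ∖ A) ≤ M(Λ ∖ E_j) − M(Λ)`; add the induction hypothesis.
The registered statement is the case `G = ℤ³`, `s = univ : Finset (Fin m)`.

References: J. L. Lebowitz, *GHS and other inequalities*, Comm. Math. Phys. 35 (1974) 87–92, §2
Remark (ii); R. B. Griffiths, C. A. Hurst, S. Sherman, J. Math. Phys. 11 (1970) 790; S. Friedli,
Y. Velenik, *Statistical Mechanics of Lattice Systems* (CUP 2017), §3.6.3 eq. (3.26), Lemma 3.22,
Exercise 3.12. No definitions are introduced; the helper lemmas are stated for an arbitrary locally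
finite graph.
-/

noncomputable section

namespace Summit.CriticalPhenomena.Ising3DConformalLimit.Cruxes.OneArmHyperscaling.MirrorFaceSaturation

open Literature.Probability.LatticeModels Finset

section General

variable {V : Type*} [DecidableEq V] (G : SimpleGraph V) [G.LocallyFinite]

/-- **One-site freezing increment of the plus magnetisation.** For `z ∈ Λ` and any `x`,
`⟨σ_x⟩⁺_{Λ∖z} − ⟨σ_x⟩⁺_Λ = (⟨σ_xσ_z⟩⁺_Λ − ⟨σ_x⟩⁺_Λ⟨σ_z⟩⁺_Λ) / (1 + ⟨σ_z⟩⁺_Λ)`: the spatial Markov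
property `⟨F⟩⁺_{Λ∖z}(1 + ⟨σ_z⟩⁺_Λ) = ⟨F⟩⁺_Λ + ⟨Fσ_z⟩⁺_Λ` (Friedli–Velenik 2017, §3.6.3 eq. (3.26);
tree `isingExpect_plus_cond`) with `F = σ_x`, divided by `1 + ⟨σ_z⟩⁺_Λ > 0`.
[cite: FriedliVelenik2017, §3.6.3 eq. (3.26)] -/
private theorem mag_erase_sub_eq {Λ : Finset V} {z : V} (hz : z ∈ Λ) (β h : ℝ) (x : V) :
    isingExpect G (Λ.erase z) β h .plus (spinAt x) - isingExpect G Λ β h .plus (spinAt x) =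
      (isingExpect G Λ β h .plus (fun σ => spinAt x σ * spinAt z σ) -
          isingExpect G Λ β h .plus (spinAt x) * isingExpect G Λ β h .plus (spinAt z)) /
        (1 + isingExpect G Λ β h .plus (spinAt z)) := by
  -- adapted from `isingTrunc_plus_le_insert` (Literature/Probability/LatticeModels/GHSTruncatedVolumeMonotonicity)
  have hz' : z ∉ Λ.erase z := Finset.notMem_erase z Λ
  have hcond := isingExpect_plus_cond G hz' β h (measurable_spinAt (V := V) x)
  have hp := one_add_isingExpect_spinAt_pos G hz' β h
  rw [Finset.insert_erase hz] at hcond hp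
  rw [eq_div_iff hp.ne']
  linear_combination hcond

/-- **The one-site freezing increment grows with the volume** (discrete GHS; Lebowitz 1974, §2
Remark (ii): the response of `⟨σ_x⟩` to a nonnegative field at `z` decreases under added nonnegative
fields, here the infinite fields freezing `Λ₂ ∖ Λ₁` to `+1`): for `β, h ≥ 0` and `x, z ∈ Λ₁ ⊆ Λ₂`,
`⟨σ_x⟩⁺_{Λ₁∖z} − ⟨σ_x⟩⁺_{Λ₁} ≤ ⟨σ_x⟩⁺_{Λ₂∖z} − ⟨σ_x⟩⁺_{Λ₂}`. By `mag_erase_sub_eq` both sides are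
`⟨σ_x;σ_z⟩⁺_{Λ_k} / (1 + ⟨σ_z⟩⁺_{Λ_k})` with `0 ≤ ⟨σ_x;σ_z⟩⁺_{Λ₁} ≤ ⟨σ_x;σ_z⟩⁺_{Λ₂}` (FKG
`ising_fkg_holds`, GHS `isingTrunc_plus_mono_volume`) and `0 < 1 + ⟨σ_z⟩⁺_{Λ₂} ≤ 1 + ⟨σ_z⟩⁺_{Λ₁}`
(`one_add_isingExpect_spinAt_pos`, GKS `isingCorr_plus_le_of_subset`).
[cite: Lebowitz1974, eq. (1.8) and §2, Remark (ii)] -/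
private theorem mag_erase_sub_mono {β h : ℝ} (hβ : 0 ≤ β) (hh : 0 ≤ h) {Λ₁ Λ₂ : Finset V}
    (h12 : Λ₁ ⊆ Λ₂) {x z : V} (hx : x ∈ Λ₁) (hz : z ∈ Λ₁) :
    isingExpect G (Λ₁.erase z) β h .plus (spinAt x) - isingExpect G Λ₁ β h .plus (spinAt x) ≤
      isingExpect G (Λ₂.erase z) β h .plus (spinAt x) - isingExpect G Λ₂ β h .plus (spinAt x) := by
  have hz2 : z ∈ Λ₂ := h12 hz
  rw [mag_erase_sub_eq G hz β h x, mag_erase_sub_eq G hz2 β h x]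
  have mx := measurable_spinAt (V := V) x
  have mz := measurable_spinAt (V := V) z
  -- `0 ≤ ⟨σ_x;σ_z⟩⁺_{Λ₁}` (FKG / GKS II)
  have hu1 : 0 ≤ isingExpect G Λ₁ β h .plus (fun σ => spinAt x σ * spinAt z σ) -
      isingExpect G Λ₁ β h .plus (spinAt x) * isingExpect G Λ₁ β h .plus (spinAt z) :=
    sub_nonneg.2 (ising_fkg_holds G hβ Λ₁ h .plus _ _ (spinAt_mono x) (spinAt_mono z) mx mz)
  -- `⟨σ_x;σ_z⟩⁺_{Λ₁} ≤ ⟨σ_x;σ_z⟩⁺_{Λ₂}` (GHS)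
  have hu12 := isingTrunc_plus_mono_volume G hβ hh h12 hx hz
  -- `0 < 1 + ⟨σ_z⟩⁺_{Λ₂}`
  have hp2 : 0 < 1 + isingExpect G Λ₂ β h .plus (spinAt z) := by
    have hp := one_add_isingExpect_spinAt_pos G (Finset.notMem_erase z Λ₂) β h
    rwa [Finset.insert_erase hz2] at hp
  -- `⟨σ_z⟩⁺_{Λ₂} ≤ ⟨σ_z⟩⁺_{Λ₁}` (GKS antitonicity of plus correlations in the volume)
  have hp12 : 1 + isingExpect G Λ₂ β h .plus (spinAt z) ≤ 1 + isingExpect G Λ₁ β h .plus (spinAt z) := by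
    have hc := isingCorr_plus_le_of_subset G hβ hh (Finset.singleton_subset_iff.2 hz) h12
    simp only [isingCorr, spinProduct_singleton] at hc
    linarith
  exact div_le_div₀ (hu1.trans hu12) hu12 hp2 hp12

/-- **Freezing a set raises the plus magnetisation by less in a smaller volume**: for `β, h ≥ 0`,
`x ∈ Λ₁ ⊆ Λ₂` and a finite `B ⊆ Λ₁` with `x ∉ B`,
`⟨σ_x⟩⁺_{Λ₁∖B} − ⟨σ_x⟩⁺_{Λ₁} ≤ ⟨σ_x⟩⁺_{Λ₂∖B} − ⟨σ_x⟩⁺_{Λ₂}`. Induction on `B`, one site at a time,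
from `mag_erase_sub_mono` (discrete GHS, Lebowitz 1974, §2 Remark (ii)).
[cite: Lebowitz1974, eq. (1.8) and §2, Remark (ii)] -/
private theorem mag_sdiff_sub_mono {β h : ℝ} (hβ : 0 ≤ β) (hh : 0 ≤ h) {Λ₁ Λ₂ : Finset V}
    (h12 : Λ₁ ⊆ Λ₂) {x : V} (hx : x ∈ Λ₁) {B : Finset V} (hxB : x ∉ B) (hB : B ⊆ Λ₁) :
    isingExpect G (Λ₁ \ B) β h .plus (spinAt x) - isingExpect G Λ₁ β h .plus (spinAt x) ≤
      isingExpect G (Λ₂ \ B) β h .plus (spinAt x) - isingExpect G Λ₂ β h .plus (spinAt x) := by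
  induction B using Finset.induction_on with
  | empty => simp
  | @insert z B hzB ih =>
    have hxB' : x ∉ B := fun h' => hxB (Finset.mem_insert_of_mem h')
    have hB' : B ⊆ Λ₁ := (Finset.subset_insert z B).trans hB
    have hz1 : z ∈ Λ₁ := hB (Finset.mem_insert_self z B)
    have hsub : Λ₁ \ B ⊆ Λ₂ \ B := Finset.sdiff_subset_sdiff h12 (Finset.Subset.refl B)
    have hxm : x ∈ Λ₁ \ B := Finset.mem_sdiff.2 ⟨hx, hxB'⟩
    have hzm : z ∈ Λ₁ \ B := Finset.mem_sdiff.2 ⟨hz1, hzB⟩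
    have step := mag_erase_sub_mono G hβ hh hsub hxm hzm
    have ih' := ih hxB' hB'
    rw [Finset.sdiff_insert, Finset.sdiff_insert]
    linarith

/-- **Submodularity of the plus magnetisation in the frozen set, finite-family form**: for
`β, h ≥ 0`, `x ∈ Λ`, a family `E` of pairwise disjoint subsets of `Λ` avoiding `x` and a finite index
set `s`, `⟨σ_x⟩⁺_{Λ∖⋃_{i∈s}E_i} + |s|·⟨σ_x⟩⁺_Λ ≤ Σ_{i∈s} ⟨σ_x⟩⁺_{Λ∖E_i} + ⟨σ_x⟩⁺_Λ`. Induction on `s`: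
the step is `mag_sdiff_sub_mono` with `Λ₁ = Λ ∖ ⋃_{i∈s}E_i ⊆ Λ₂ = Λ`, `B = E_j` (discrete GHS,
Lebowitz 1974, §2 Remark (ii)). [cite: Lebowitz1974, eq. (1.8) and §2, Remark (ii)] -/
private theorem mag_submodular_finset {β h : ℝ} (hβ : 0 ≤ β) (hh : 0 ≤ h) {Λ : Finset V} {x : V}
    (hx : x ∈ Λ) {ι : Type*} [DecidableEq ι] (E : ι → Finset V) (hxE : ∀ i, x ∉ E i)
    (hEΛ : ∀ i, E i ⊆ Λ) (hdisj : ∀ i j, i ≠ j → Disjoint (E i) (E j)) (s : Finset ι) :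
    isingExpect G (Λ \ s.biUnion E) β h .plus (spinAt x) +
        (s.card : ℝ) * isingExpect G Λ β h .plus (spinAt x) ≤
      (∑ i ∈ s, isingExpect G (Λ \ E i) β h .plus (spinAt x)) +
        isingExpect G Λ β h .plus (spinAt x) := by
  induction s using Finset.induction_on with
  | empty => simp
  | @insert j s hjs ih =>
    rw [Finset.biUnion_insert, Finset.sum_insert hjs, Finset.card_insert_of_notMem hjs]
    push_cast
    have hdj : Disjoint (E j) (s.biUnion E) := by
      rw [Finset.disjoint_biUnion_right]
      intro i hi
      exact hdisj j i fun h' => hjs (h' ▸ hi)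
    have hsub : E j ⊆ Λ \ s.biUnion E := Finset.subset_sdiff.2 ⟨hEΛ j, hdj⟩
    have hxm : x ∈ Λ \ s.biUnion E := by
      refine Finset.mem_sdiff.2 ⟨hx, ?_⟩
      rw [Finset.mem_biUnion]
      rintro ⟨i, -, hi⟩
      exact hxE i hi
    have step := mag_sdiff_sub_mono G hβ hh Finset.sdiff_subset hxm (hxE j) hsub
    have hset : (Λ \ s.biUnion E) \ E j = Λ \ (E j ∪ s.biUnion E) := by
      ext y
      simp only [Finset.mem_sdiff, Finset.mem_union, not_or]
      tauto
    rw [hset] at step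
    linarith

end General

/-- **`PlusMagSubmodular`** (registered stub `stub_plusMagSubmodular` of the line
`mirror-face-saturation`, crux `OneArmHyperscaling`, item stmt-CriticalPhenomena-15591): discrete GHS
submodularity of the plus magnetisation of the nearest-neighbour Ising model on `ℤ³` in the frozen
set — for `β, h ≥ 0`, `x ∈ Λ` and `m` pairwise disjoint sets `E_i ⊆ Λ` avoiding `x`,
`⟨σ_x⟩⁺_{Λ∖⋃E} + m·⟨σ_x⟩⁺_Λ ≤ Σ_i ⟨σ_x⟩⁺_{Λ∖E_i} + ⟨σ_x⟩⁺_Λ`. The case `G = ℤ³`, `s = univ` of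
`mag_submodular_finset` (spatial Markov property, Friedli–Velenik 2017 eq. (3.26); GHS, Lebowitz
1974, §2 Remark (ii); GKS; FKG). [cite: Lebowitz1974, eq. (1.8) and §2, Remark (ii)] -/
theorem stub_plusMagSubmodular : MirrorFaceSaturation.PlusMagSubmodular := by
  intro β h hβ hh Λ x m E hx hxE hEΛ hdisj
  have key := mag_submodular_finset (zdGraph 3) hβ hh hx E hxE hEΛ hdisj Finset.univ
  simpa only [Finset.card_univ, Fintype.card_fin] using key

end Summit.CriticalPhenomena.Ising3DConformalLimit.Cruxes.OneArmHyperscaling.MirrorFaceSaturation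

end
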